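import Summits.BirchSwinnertonDyer.BirchSwinnertonDyer.Theorems.KolyvaginDepthDoorDefs
import Summits.BirchSwinnertonDyer.BirchSwinnertonDyer.Theorems.KolyvaginDepthDoorKolyvaginDepthSupplyDoorSecondSign
import Summits.BirchSwinnertonDyer.BirchSwinnertonDyer.Theses.KolyvaginDepthDoor
import Summits.BirchSwinnertonDyer.BirchSwinnertonDyer.Theses.KatoTransfer
import HarnessLib

/-!
# Route `KolyvaginDepthDoor`, crux `KolyvaginDepthSupply` (stmt-BirchSwinnertonDyer-21765) —
# THE SIGNED DATUM ON THE KODAIRA–NÉRON CELL OF ITS WITNESS PRIME REACHES X1 AND BSD-RANK MODULO (γ)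
# ALONE: `KolyvaginDepthSupplySignedDatumKN` + (γ) ⟹ X1|nonCM; + X1_CM + X2 + X3 + Kato ⟹ BSD — no F1,
# no `KolyvaginStructure`, no McCallum leaf

Helper file (`--supports stmt-BirchSwinnertonDyer-21765 --as helper`); it closes nothing and BSD is
not proved by it.

`…KolyvaginDepthSupplySignedDatumDoor` (this seat) reaches BSD from `KolyvaginDepthSupplySignedDatum`
modulo TWO named inputs, (γ) = `GrossLMS1991.prop37_2_frobeniusCongruence` and F1 =
`Gross1991_heegnerPoint_sub_ratTorsion_mem_E0`; F1 is needed only to supply McCallum's Lemma 4.3 at the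
multiplicative places `v` with `p ∣ ord_v(Δ_min)`. Since the crux CHOOSES its prime, the Kodaira–Néron
side condition (KN_p) can be made part of the witness — the definition
`KolyvaginDepthSupplySignedDatumKN` (file `…KolyvaginDepthDoorDefs`) — and then Lemma 4.3 is the tree
theorem `kolyvaginClass_mem_selmerLocalKer_finite_one_of_kodairaNeron` (x11b3 / g8): the doors
`…_of_datum_kodairaNeron` (first sign, g8) and `…_of_twist_rank_of_datum_kodairaNeron` (second sign, g9)
apply, and F1 disappears from the route.

* `kolyvaginDepthSupplySignedDatum_of_KN` — the KN form implies the plain signed form (drop (KN_p)).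
* `shaCorank_eq_zero_nonCM_of_kolyvaginDepthSupplySignedDatumKN_print` — KN signed datum + (γ) ⟹ X1 on
  non-CM curves, with Kolyvagin's exact two-sign rank clause at the witness, `Ш(E/ℚ)[p] = 0` and
  `#Sel_p(E/ℚ) = p^{rank}`.
* `shaCorankZeroAtOnePrime_of_kolyvaginDepthSupplySignedDatumKN_print` — with the CM residual: LITERALLY
  `KatoTransfer.ShaCorankZeroAtOnePrime` (stmt-BirchSwinnertonDyer-18411).
* `bsd_of_kolyvaginDepthSupplySignedDatumKN_print` — KN signed datum + (γ) + X1_CM + X2 + X3 + Kato ⟹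
  `BirchSwinnertonDyer`, X1 handed to `KatoTransfer.closes`.

Every hypothesis is OPEN (the KN signed datum — of the strength of «`Ш(E/ℚ)[p] = 0` at an admissible
Kodaira–Néron prime» on non-CM curves —, X1_CM, X2, X3, Kato) or the ONE named published fact (γ)
(Gross 1991 Prop. 3.7 (2), the Eichler–Shimura congruence for Heegner points of consecutive conductors);
NOTHING class-wide is discharged and BSD is NOT proved by this.

References: [Kolyvagin1991MathAnn] Thm. 2.3, Thm. 4; [GrossLMS1991] Prop. 3.7 (2), §5 (5.1), Prop. 6.2 (1),
§10; [McCallumLMS1991] §§2–5; [SilvermanAEC2009] VII.6.1; [Kato2004Asterisque] Thm. 17.4.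
-/

set_option linter.dupNamespace false

noncomputable section

open scoped Classical

namespace Summit.BirchSwinnertonDyer.BirchSwinnertonDyer.Theorems.KolyvaginDepthDoor

open Literature Literature.NumberTheory.EllipticCurves Literature.NumberTheory.EllipticCurves.ModularForms
  WeierstrassCurve NumberField IsDedekindDomain
open Literature.NumberTheory.DiophantineGeometry (KodairaSymbol)
open Summit.BirchSwinnertonDyer.BirchSwinnertonDyer.Theses.KolyvaginDepthDoor

/-- **The KN signed datum implies the signed datum** (drop the Kodaira–Néron conjunct).
[cite: Kolyvagin1991MathAnn, Thm. 2.3] -/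
theorem kolyvaginDepthSupplySignedDatum_of_KN (hS : KolyvaginDepthSupplySignedDatumKN) :
    KolyvaginDepthSupplySignedDatum := by
  intro W _ _ hcm
  obtain ⟨p, hp, h5, hgood, hord, htower, -, K, iF, iN, hK, hD3, hD4, iNZ, hH, Dt, β, ι, n₁, d, hn₁,
    hk₁, hne, hrank⟩ := hS W hcm
  exact ⟨p, hp, h5, hgood, hord, htower, K, iF, iN, hK, hD3, hD4, iNZ, hH, Dt, β, ι, n₁, d, hn₁, hk₁,
    hne, hrank⟩

/-- **KN signed datum + (γ) ⟹ X1 on non-CM curves, with the crux's rank clause at the witness — NO F1.**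
Granted `KolyvaginDepthSupplySignedDatumKN` and (γ) = `GrossLMS1991.prop37_2_frobeniusCongruence`: every
non-CM globally minimal elliptic `E/ℚ` has a prime `p ≥ 5` of good ordinary reduction with
`corank_{ℤ_p} Ш(E/ℚ)[p^∞] = 0`; at the witness `(K, n₁)` Kolyvagin's exact two-sign rank clause holds, and
`Ш(E/ℚ)[p] = 0`, `#Sel_p(E/ℚ) = p^{rank}`. Proof: the witness prime is on the Kodaira–Néron cell, so the
doors `shaCorank_eq_zero_of_kolyvaginClass_ne_zero_of_rank_le_of_datum_kodairaNeron` (first sign) and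
`…_of_twist_rank_of_datum_kodairaNeron` (second sign) apply; their additive clause is void for `p ≥ 5`.
CONDITIONAL on `hS` and (γ); BSD is not proved by it. [cite: Kolyvagin1991MathAnn, Thm. 2.3]
[cite: GrossLMS1991, Prop. 3.7 (2), §5 (5.1), Prop. 6.2 (1), §10] [cite: SilvermanAEC2009, VII.6.1] -/
theorem shaCorank_eq_zero_nonCM_of_kolyvaginDepthSupplySignedDatumKN_print
    (hS : KolyvaginDepthSupplySignedDatumKN) (h372 : GrossLMS1991.prop37_2_frobeniusCongruence)
    (W : WeierstrassCurve ℚ) [W.IsElliptic] [W.IsGloballyMinimal] (hcm : ¬ W.HasCM) :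
    ∃ (p : ℕ) (_ : Fact p.Prime), 5 ≤ p ∧ W.HasGoodReductionAtPrime p ∧
      ¬ (p : ℤ) ∣ W.frobeniusTrace p ∧ W.shaCorank p = 0 ∧
      ∃ (K : Type) (_ : Field K) (_ : NumberField K) (n₁ : ℕ), IsImaginaryQuadratic K ∧
        ((n₁.primeFactors.card + 1 = W.mordellWeilRank ∧
            (W.quadraticTwist (NumberField.discr K : ℚ)).mordellWeilRank < W.mordellWeilRank) ∨
          (n₁.primeFactors.card = W.mordellWeilRank ∧
            (W.quadraticTwist (NumberField.discr K : ℚ)).mordellWeilRank = W.mordellWeilRank + 1)) ∧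
        W.sha ⊓ AddSubgroup.torsionBy W.galH1 ((p ^ 1 : ℕ) : ℤ) = ⊥ ∧
        Nat.card ↥(selmerGroup W ((p ^ 1 : ℕ) : ℤ)) = p ^ W.mordellWeilRank := by
  obtain ⟨p, hp, h5, hgood, hord, htower, hmult, K, iF, iN, hK, hD3, hD4, iNZ, hH, Dt, β, ι, n₁, d, hn₁,
    hk₁, hne, hrank⟩ := hS W hcm
  haveI := hp
  haveI := iNZ
  have hp2 : p ≠ 2 := by omega
  have hadd : ∀ v : HeightOneSpectrum (𝓞 ℚ), W.HasAdditiveReductionAt v → p ≠ 3 ∨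
      (W.kodairaSymbolAt v ≠ KodairaSymbol.IV ∧ W.kodairaSymbolAt v ≠ KodairaSymbol.IVstar) :=
    fun _ _ ↦ Or.inl (by omega)
  obtain ⟨c, hc, hcc⟩ := exists_conj_of_isImaginaryQuadratic K hK
  rcases hrank with hrank | ⟨hrank, hrank'⟩
  · obtain ⟨hsha, hr, hr', -, hbot, hSel⟩ :=
      shaCorank_eq_zero_of_kolyvaginClass_ne_zero_of_rank_le_of_datum_kodairaNeron h372 hcm hK hD3 hD4
        hH p hp2 htower c hc hcc hmult hadd hn₁ hk₁ d hne hrank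
    refine ⟨p, hp, h5, hgood, hord, hsha, K, iF, iN, n₁, hK, Or.inl ⟨hr.symm, by omega⟩, hbot, ?_⟩
    rw [hSel, hr]
  · obtain ⟨hsha, hr, -, hr', -, hbot, hSel, -⟩ :=
      shaCorank_eq_zero_of_kolyvaginClass_ne_zero_of_twist_rank_of_datum_kodairaNeron h372 hcm hK hD3
        hD4 hH p hp2 htower c hc hcc hmult hadd hn₁ hk₁ d hne hrank hrank'
    refine ⟨p, hp, h5, hgood, hord, hsha, K, iF, iN, n₁, hK, Or.inr ⟨hr.symm, by omega⟩, hbot, ?_⟩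
    rw [hSel, hr]

/-- **KN signed datum + (γ) + the CM residual ⟹ X1 for every elliptic curve over `ℚ`** — LITERALLY
`KatoTransfer`'s crux `ShaCorankZeroAtOnePrime` (stmt-BirchSwinnertonDyer-18411), modulo the ONE named
input (γ). CONDITIONAL on `hS`, (γ), `hCM`; BSD is not proved by it. [cite: Kolyvagin1991MathAnn, Thm. 2.3]
[cite: GrossLMS1991, Prop. 3.7 (2)] -/
theorem shaCorankZeroAtOnePrime_of_kolyvaginDepthSupplySignedDatumKN_print
    (hS : KolyvaginDepthSupplySignedDatumKN) (h372 : GrossLMS1991.prop37_2_frobeniusCongruence)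
    (hCM : ShaCorankZeroAtOnePrimeOfCM) :
    Summit.BirchSwinnertonDyer.BirchSwinnertonDyer.Theses.KatoTransfer.ShaCorankZeroAtOnePrime := by
  intro W _ _
  by_cases hcm : W.HasCM
  · exact hCM W hcm
  · obtain ⟨p, hp, h5, hgood, hord, hsha, -⟩ :=
      shaCorank_eq_zero_nonCM_of_kolyvaginDepthSupplySignedDatumKN_print hS h372 W hcm
    exact ⟨p, hp, h5, hgood, hord, hsha⟩

/-- **The route from the KN signed datum: `KolyvaginDepthSupplySignedDatumKN` + (γ) + X1_CM + X2 + X3 +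
Kato ⟹ BSD-rank — ONE named published input.** Hypotheses: the KN signed datum, (γ), and the route's
items `ShaCorankZeroAtOnePrimeOfCM`, `AnalyticRankLeSelmerCorank`, `PadicOrderLeAnalyticRankAtOnePrime`,
`KatoRankBound` VERBATIM; conclusion `_root_.BirchSwinnertonDyer`; X1 handed to `KatoTransfer.closes`.
NEITHER F1, NOR `KolyvaginStructure`, NOR any McCallum leaf is used. Every hypothesis is OPEN or the
named fact (γ); NOTHING is discharged and BSD is NOT proved by this. [cite: Kolyvagin1991MathAnn, Thm. 2.3]
[cite: Kato2004Asterisque, Thm. 17.4] [cite: GrossLMS1991, Prop. 3.7 (2)] -/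
theorem bsd_of_kolyvaginDepthSupplySignedDatumKN_print (hS : KolyvaginDepthSupplySignedDatumKN)
    (h372 : GrossLMS1991.prop37_2_frobeniusCongruence) (hCM : ShaCorankZeroAtOnePrimeOfCM)
    (hX2 : AnalyticRankLeSelmerCorank) (hX3 : PadicOrderLeAnalyticRankAtOnePrime)
    (hK : KatoRankBound) : _root_.BirchSwinnertonDyer :=
  Summit.BirchSwinnertonDyer.BirchSwinnertonDyer.Theses.KatoTransfer.closes
    (shaCorankZeroAtOnePrime_of_kolyvaginDepthSupplySignedDatumKN_print hS h372 hCM) hX2 hX3 hK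

end Summit.BirchSwinnertonDyer.BirchSwinnertonDyer.Theorems.KolyvaginDepthDoor

end
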